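import Mathlib.MeasureTheory.Measure.Portmanteau
import Mathlib.Topology.MetricSpace.Closeds
import Literature.Probability.Percolation.TriAnnulusCircuit
import HarnessLib

/-!
# The one-arm exponent: LSW's continuum input split as printed (scaling limit + Thm. 1.2)

Topic `Literature/Probability/Percolation`; family `crit-perc` (critical site percolation on the
triangular lattice `𝕋`). This file continues the discharge of the named fact
`Literature.Probability.Percolation.oneArm_exponent` (`ArmExponents.lean`; Lawler–Schramm–Werner, *One-arm exponent
for critical 2D percolation*, Electron. J. Probab. 7 (2002), paper no. 2, Thm. 1.1).

`OneArmLSW.lean` proves `oneArm_exponent` from two named facts, the continuum input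
`LawlerSchrammWerner2002_annulusCrossing` (LSW Thm. 1.2 combined with LSW (3.1)) and the RSW
input `BollobasRiordan2006_openCircuit`, and `TriAnnulusCircuit.lean` proves the latter from the
box-crossing property `tri_rsw_half`. Here the continuum input is split into the two statements
that LSW actually print, and the printed deduction between them is PROVED:

* the *existence of the scaling limit* (LSW §2, p. 3: "Let `Q(θ)` denote a random subset of `Ū`
  whose law is the weak limit as `δ ↓ 0` of the law of `Q_δ(θ)`. (The law of `Q_δ(θ)` can be
  thought of as a probability measure on the Hausdorff space of compact subsets of `Ū`.) By
  [22, 23], the limit exists", [22] = Smirnov, C. R. Acad. Sci. Paris 333 (2001), [23] = "S. Smirnov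
  (2001), in preparation"; the full scaling limit with proofs is Camia–Newman, Comm. Math. Phys. 268
  (2006)) enters the theorems below as the EXPLICIT HYPOTHESIS
  `∃ ν : ProbabilityMeasure (NonemptyCompacts ℂ), Tendsto lswLaw atTop (𝓝 ν)`: the laws `lswLaw R`
  of the rescaled sets `Q_{1/R} = lswCompact R` converge weakly, as `R → ∞`, in the space of Borel
  probability measures on the Hausdorff metric space `NonemptyCompacts ℂ` (Mathlib's
  `NonemptyCompacts.instMetricSpace`). It was briefly a named fact
  (`LawlerSchrammWerner2002_scalingLimit`, 2026-08-14/15); the D-0026 review of that decomposition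
  (2026-08-15) merged it back: LSW's printed proof of Thms. 1.1–1.2 and (3.1) uses the weak limit
  only through Theorem 2.1 (Smirnov's `SLE₆` description of `Q(θ)`), and the tree proves all of them
  from that identification read at SUBSEQUENTIAL weak limits of `lswLaw`, which exist for free
  (`exists_tendsto_lswLaw_subseq`, `OneArmSubsequentialLimits.lean`; the assembly is
  `LawlerSchrammWerner2002_continuumFacts_of_subseqTrace`, `OneArmAnnulusCrossingFromTrace.lean`).
  The existence of the full limit — in the literature the Camia–Newman loop ensemble plus the passage
  from loops to clusters (or the quad-crossing limit of Schramm–Smirnov with the arm-event continuity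
  of Garban–Pete–Schramm), a theory of its own — is thus on no proof path of this library and is
  kept as a hypothesis where a theorem wants it, never as debt. Its elementary structure theory is
  proved in `OneArmScalingLimitProofs.lean` (limit exists ⇔ subsequential limits coincide) and
  `OneArmScalingLimitConnection.lean` (⇔ convergence of connection probabilities).
* `LawlerSchrammWerner2002_scalingLimitExponent` (named fact; LSW Thm. 1.2, p. 2, verbatim):
  for the weak limit `Q`, "There is a constant `c > 0` such that for all `r ∈ (0, 1/2)`,
  `c⁻¹ r^{5/48} ≤ P[dist(Q, 0) < r] ≤ c r^{5/48}`" (`dist(0, Q) = infDist 0 Q`, the event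
  `meetsBall r`). Its proof is the radial `SLE₆` computation of LSW §2 (Thm. 2.1, Lemmas 2.2–2.3,
  (2.17)) and stays a named fact.
* `LawlerSchrammWerner2002_annulusCrossing_of_scalingLimit` (THEOREM): the existence of the weak
  limit and the fact imply `LawlerSchrammWerner2002_annulusCrossing`. This is LSW's sentence "By
  the definition of the scaling limit it follows that for all fixed `r ∈ (0, 1)` there is some
  `s₀ = s₀(r)` such that
  `∀ R ≥ s₀, u(r/2)/2 ≤ P[C(rR, R)] ≤ 2 u(2r)`" ((3.1), p. 8) — here the portmanteau theorem
  (Mathlib's `ProbabilityMeasure.limsup_measure_closed_le_of_tendsto`,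
  `ProbabilityMeasure.le_liminf_measure_open_of_tendsto`) applied to the open event `meetsBall r`
  and the closed event `meetsClosedBall r` of the Hausdorff space, using the exact identity
  `C(rR, R) = {Q_{1/R} ∈ meetsBall r}` (`mem_triOpenCrossing_iff_lswCompact`) — together with
  LSW's "By Theorem 1.2, `log u(r) / log r → 5/48` as `r ↓ 0`" (p. 9, first line; here
  `tendsto_log_div_log_of_rpow_bounds`, with `u(r) = P[Q ∈ meetsClosedBall r]`).
* `oneArm_exponent_of_scalingLimit_of_rsw` (THEOREM): the one-arm exponent from the existence of
  the weak limit, the fact and `tri_rsw_half`; `oneArm_exponent_of_scalingLimit` the same with the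
  RSW circuit fact `BollobasRiordan2006_openCircuit` as hypothesis.

## The discrete sets `Q_δ`

LSW (§2, p. 3) colour the hexagonal faces of the dual grid of `δ𝕋` and let `Q_δ(2π)` be the union
of `∂𝕌` with the connected components of (black hexagons) `∩ Ū` meeting `∂𝕌`. We render this on
the lattice `𝕋` at mesh `δ = 1/R`: `lswSites R ω` is the set of sites `x` with `‖x‖ < R` joined
by an open path of `𝕋` to a site `y` with `‖y‖ > R` (equivalently, by first exit
(`lswSites_inter_eq`), the open clusters of the disc `‖·‖ ≤ R` having an open neighbour outside
it), and `lswSet R ω = ∂𝕌 ∪ R⁻¹ · lswSites R ω`, a nonempty compact subset of `Ū`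
(`lswCompact R ω : NonemptyCompacts ℂ`). The two renderings differ only in how "meeting `∂𝕌`" is
discretised within two lattice spacings of the circle `C_R` (hexagons cut by `∂𝕌` versus an open
edge across `C_R`) and by the Hausdorff-distance-`δ` replacement of hexagons by their centres;
the sites outside `C_R` being independent of the clusters of the disc, a cluster of the disc with
`k` distinct lattice neighbours outside `C_R` is retained here with conditional probability at least
`1 - 2^{-k}`, and clusters of diameter `≥ ε R` approaching `C_R` at few sites are asymptotically
improbable (a boundary three-arm event, cf. LSW (2.13) and Appendix A), so the two renderings are
close in Hausdorff distance with probability tending to one and have the same weak limits. As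
everywhere in this library (hexagons `Λ_n` versus circles in `oneArm_exponent`, cf. the
faithfulness notes of `OneArmLSW.lean` and `ArmExponentsTwoArm.lean`) such boundary
discretisations are immaterial to the cited statements, and the present choice makes LSW's
annulus-crossing event *exactly* a cylinder event of `Q_δ`:
`C(rR, R) = {ω | lswCompact R ω ∈ meetsBall r}` for `0 < r ≤ 1 ≤ R` (`mem_triOpenCrossing_iff_lswCompact`).
The weak limit being unique (the space of probability measures is Hausdorff), Thm. 1.2 is
recorded for every weak limit `ν` of `lswLaw`.

## Contents

* `instMeasurableSpaceNonemptyCompacts`, `instBorelSpaceNonemptyCompacts` — the Borel σ-algebra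
  of the Hausdorff metric on `NonemptyCompacts ℂ` (LSW's "Hausdorff space of compact subsets").
* `meetsBall r = {K | infDist 0 K < r}` (open), `meetsClosedBall r = {K | infDist 0 K ≤ r}` (closed).
* `lswSites`, `lswSet`, `lswCompact`, locality `lswSites_inter_eq`, measurability
  `measurable_lswCompact`, the laws `lswLaw R`, `lswLaw_apply`,
  `mem_triOpenCrossing_iff_lswCompact`, `real_triOpenCrossing_eq`.
* `tendsto_log_div_log_of_rpow_bounds` — `L r^a ≤ u(r) ≤ U r^a` near `0⁺` gives
  `log u(r) / log r → a`.
* the named fact `LawlerSchrammWerner2002_scalingLimitExponent` and the three theorems above.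

Mathlib: `TopologicalSpace.NonemptyCompacts`, `Metric.NonemptyCompacts.instMetricSpace`,
`Metric.lipschitz_infDist_set`, `MeasureTheory.ProbabilityMeasure` (topology of weak convergence,
`ProbabilityMeasure.map`), the portmanteau implications quoted above; no percolation, no `SLE`.
Tree: `triOpenCrossing`, `mem_triOpenCrossing_iff`, `subset_box_of_norm_le`,
`norm_triEmbed_le_of_adj`, `LawlerSchrammWerner2002_annulusCrossing`, `oneArm_exponent_of_LSW`
(`OneArmLSW.lean`), `oneArm_exponent_of_LSW_of_rsw` (`TriAnnulusCircuit.lean`), `PathIn.exit`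
(`SitePaths.lean`), `DeterminedBy.measurableSet_of_finset` (`PercolationEvents.lean`).

## References

* G. F. Lawler, O. Schramm, W. Werner, *One-arm exponent for critical 2D percolation*, Electron.
  J. Probab. 7 (2002), no. 2 — Thm. 1.1, Thm. 1.2 (p. 2), §2 (p. 3), §3 (3.1) (pp. 8–9)
  [LawlerSchrammWernerEJP2002].
* S. Smirnov, *Critical percolation in the plane: conformal invariance, Cardy's formula, scaling
  limits*, C. R. Acad. Sci. Paris 333 (2001) 239–244; long version *Critical percolation in the
  plane. I. Conformal invariance and Cardy's formula. II. Continuum scaling limit*,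
  arXiv:0909.4499, §3, Thms. 2–4 [Smirnov2001].
* F. Camia, C. M. Newman, *Two-dimensional critical percolation: the full scaling limit*, Comm.
  Math. Phys. 268 (2006) 1–38, Thm. 1 [CamiaNewman2006].
-/

noncomputable section

open MeasureTheory Filter Topology Metric TopologicalSpace Literature.Probability.LatticeModels Literature.Probability.Percolation
open scoped ENNReal NNReal

namespace Literature.Probability.Percolation

/-! ### The Hausdorff space of compact subsets of the plane as a Borel space -/

/-- The Borel σ-algebra of the Hausdorff metric on the nonempty compact subsets of `ℂ` (LSW 2002,
§2, p. 3: "a probability measure on the Hausdorff space of compact subsets of `Ū`").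
[cite: LawlerSchrammWernerEJP2002, §2 (p. 3)] -/
instance instMeasurableSpaceNonemptyCompacts : MeasurableSpace (NonemptyCompacts ℂ) := borel _

/-- `NonemptyCompacts ℂ` with the σ-algebra above is a Borel space (by definition). [folklore] -/
instance instBorelSpaceNonemptyCompacts : BorelSpace (NonemptyCompacts ℂ) := ⟨rfl⟩

/-- The event `dist(0, K) < r` of the Hausdorff space (LSW 2002, Thm. 1.2: `dist(Q, 0) < r`).
[cite: LawlerSchrammWernerEJP2002, Thm. 1.2 (p. 2)] -/
def meetsBall (r : ℝ) : Set (NonemptyCompacts ℂ) :=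
  {K | infDist (0 : ℂ) (K : Set ℂ) < r}

/-- The event `dist(0, K) ≤ r`, i.e. `K` meets the closed disc `r Ū` (LSW 2002, §3, p. 8: `u(r)`,
the probability that `Q` meets `r ∂𝕌`, equivalently `r Ū` for the connected set `Q ⊇ ∂𝕌`).
[cite: LawlerSchrammWernerEJP2002, §3 (p. 8)] -/
def meetsClosedBall (r : ℝ) : Set (NonemptyCompacts ℂ) :=
  {K | infDist (0 : ℂ) (K : Set ℂ) ≤ r}

/-- Membership in `meetsBall`, unfolded. [folklore] -/
@[simp] theorem mem_meetsBall_iff {r : ℝ} {K : NonemptyCompacts ℂ} :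
    K ∈ meetsBall r ↔ infDist (0 : ℂ) (K : Set ℂ) < r := Iff.rfl

/-- Membership in `meetsClosedBall`, unfolded. [folklore] -/
@[simp] theorem mem_meetsClosedBall_iff {r : ℝ} {K : NonemptyCompacts ℂ} :
    K ∈ meetsClosedBall r ↔ infDist (0 : ℂ) (K : Set ℂ) ≤ r := Iff.rfl

/-- `K ↦ dist(0, K)` is continuous (indeed `1`-Lipschitz) for the Hausdorff metric. [folklore] -/
theorem continuous_infDist_zero_nonemptyCompacts :
    Continuous fun K : NonemptyCompacts ℂ => infDist (0 : ℂ) (K : Set ℂ) :=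
  (Metric.lipschitz_infDist_set (0 : ℂ)).continuous

/-- `meetsBall r` is open in the Hausdorff space. [folklore] -/
theorem isOpen_meetsBall (r : ℝ) : IsOpen (meetsBall r) :=
  isOpen_Iio.preimage continuous_infDist_zero_nonemptyCompacts

/-- `meetsClosedBall r` is closed in the Hausdorff space. [folklore] -/
theorem isClosed_meetsClosedBall (r : ℝ) : IsClosed (meetsClosedBall r) :=
  isClosed_Iic.preimage continuous_infDist_zero_nonemptyCompacts

/-- `meetsBall r ⊆ meetsClosedBall r`. [folklore] -/
theorem meetsBall_subset_meetsClosedBall (r : ℝ) : meetsBall r ⊆ meetsClosedBall r :=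
  fun _ hK => mem_meetsClosedBall_iff.2 (le_of_lt (mem_meetsBall_iff.1 hK))

/-- `meetsClosedBall r ⊆ meetsBall r'` for `r < r'`. [folklore] -/
theorem meetsClosedBall_subset_meetsBall {r r' : ℝ} (h : r < r') :
    meetsClosedBall r ⊆ meetsBall r' :=
  fun _ hK => mem_meetsBall_iff.2 (lt_of_le_of_lt (mem_meetsClosedBall_iff.1 hK) h)

/-- `meetsClosedBall` is monotone in the radius. [folklore] -/
theorem meetsClosedBall_mono {r r' : ℝ} (h : r ≤ r') :
    meetsClosedBall r ⊆ meetsClosedBall r' :=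
  fun _ hK => mem_meetsClosedBall_iff.2 (le_trans (mem_meetsClosedBall_iff.1 hK) h)

/-! ### LSW's discrete sets `Q_δ`, `δ = 1/R` -/

/-- The sites of `Q_δ` at mesh `δ = 1/R` before rescaling: sites `x` of `𝕋` with `‖x‖ < R` joined
by an open path to a site `y` with `‖y‖ > R` (LSW 2002, §2, p. 3: the clusters in `Ū` meeting
`∂𝕌`; see the module docstring for the discretisation).
[cite: LawlerSchrammWernerEJP2002, §2 (p. 3)] -/
def lswSites (R : ℝ) (ω : SiteConfig (Site 2)) : Set (Site 2) :=
  {x | ‖triEmbed x‖ < R ∧ ∃ y : Site 2, R < ‖triEmbed y‖ ∧ PathIn triGraph ω x y}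

/-- Membership in `lswSites`, unfolded. [folklore] -/
theorem mem_lswSites_iff {R : ℝ} {ω : SiteConfig (Site 2)} {x : Site 2} :
    x ∈ lswSites R ω ↔
      ‖triEmbed x‖ < R ∧ ∃ y : Site 2, R < ‖triEmbed y‖ ∧ PathIn triGraph ω x y :=
  Iff.rfl

/-- `lswSites R ω` lies in the box of size `⌈2R⌉`. [folklore] -/
theorem lswSites_subset_box (R : ℝ) (ω : SiteConfig (Site 2)) :
    lswSites R ω ⊆ ↑(box 2 ⌈2 * R⌉₊) :=
  subset_box_of_norm_le fun _ hv => hv.1.le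

/-- `lswSites R ω` is finite. [folklore] -/
theorem finite_lswSites (R : ℝ) (ω : SiteConfig (Site 2)) : (lswSites R ω).Finite :=
  (Finset.finite_toSet _).subset (lswSites_subset_box R ω)

/-- **Locality of `Q_δ`.** `lswSites R` only depends on the sites of norm at most `R + 1`: by first
exit from the disc `‖·‖ ≤ R`, a witnessing open path may be stopped at its first site outside the
disc. [folklore] -/
theorem lswSites_inter_eq {R : ℝ} (ω : SiteConfig (Site 2)) {T : Set (Site 2)}
    (hT : {v : Site 2 | ‖triEmbed v‖ ≤ R + 1} ⊆ T) : lswSites R (ω ∩ T) = lswSites R ω := by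
  ext x
  constructor
  · rintro ⟨hx, y, hy, hp⟩
    exact ⟨hx, y, hy, hp.mono Set.inter_subset_left⟩
  · rintro ⟨hx, y, hy, hp⟩
    obtain ⟨a, b, ha, hb, hbω, hab, hpa⟩ :=
      hp.exit (R := {v : Site 2 | ‖triEmbed v‖ ≤ R}) (show ‖triEmbed x‖ ≤ R from hx.le)
        (show ¬ (‖triEmbed y‖ ≤ R) from not_le.2 hy)
    have ha' : ‖triEmbed a‖ ≤ R := ha
    have hb' : R < ‖triEmbed b‖ := not_le.1 hb
    have hbT : b ∈ T := by
      apply hT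
      show ‖triEmbed b‖ ≤ R + 1
      have := norm_triEmbed_le_of_adj hab
      linarith
    have hpa' : PathIn triGraph (ω ∩ T) x a := by
      refine hpa.mono fun v hv => ⟨hv.2, hT ?_⟩
      have hv1 : ‖triEmbed v‖ ≤ R := hv.1
      show ‖triEmbed v‖ ≤ R + 1
      linarith
    exact ⟨hx, b, hb', hpa'.tail hab ⟨hbω, hbT⟩⟩

/-- Configurations agreeing on the sites of norm at most `R + 1` have the same `lswSites R`.
[folklore] -/
theorem lswSites_congr {R : ℝ} {ω ω' : SiteConfig (Site 2)} {T : Set (Site 2)}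
    (hT : {v : Site 2 | ‖triEmbed v‖ ≤ R + 1} ⊆ T) (h : ω ∩ T = ω' ∩ T) :
    lswSites R ω = lswSites R ω' := by
  rw [← lswSites_inter_eq ω hT, h, lswSites_inter_eq ω' hT]

/-- The rescaled set `Q_δ = ∂𝕌 ∪ δ · lswSites`, `δ = 1/R`, a subset of `Ū` (LSW 2002, §2, p. 3:
`Q_δ(2π) ⊇ A_{2π} = ∂𝕌`). [cite: LawlerSchrammWernerEJP2002, §2 (p. 3)] -/
def lswSet (R : ℝ) (ω : SiteConfig (Site 2)) : Set ℂ :=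
  Metric.sphere (0 : ℂ) 1 ∪ triMeshPoint R⁻¹ '' lswSites R ω

/-- `Q_δ` is compact (a circle and finitely many points). [folklore] -/
theorem isCompact_lswSet (R : ℝ) (ω : SiteConfig (Site 2)) : IsCompact (lswSet R ω) :=
  (isCompact_sphere (0 : ℂ) 1).union ((finite_lswSites R ω).image _).isCompact

/-- `1 ∈ ∂𝕌 ⊆ Q_δ`. [folklore] -/
theorem one_mem_lswSet (R : ℝ) (ω : SiteConfig (Site 2)) : (1 : ℂ) ∈ lswSet R ω :=
  Or.inl (by simp)

/-- `Q_δ` as a point of the Hausdorff space of nonempty compact subsets of `ℂ` (LSW 2002, §2,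
p. 3). [cite: LawlerSchrammWernerEJP2002, §2 (p. 3)] -/
def lswCompact (R : ℝ) (ω : SiteConfig (Site 2)) : NonemptyCompacts ℂ :=
  ⟨⟨lswSet R ω, isCompact_lswSet R ω⟩, ⟨1, one_mem_lswSet R ω⟩⟩

/-- The underlying set of `lswCompact`. [folklore] -/
@[simp] theorem coe_lswCompact (R : ℝ) (ω : SiteConfig (Site 2)) :
    (lswCompact R ω : Set ℂ) = lswSet R ω := rfl

/-- Configurations agreeing on the sites of norm at most `R + 1` have the same `Q_δ`. [folklore] -/
theorem lswCompact_congr {R : ℝ} {ω ω' : SiteConfig (Site 2)} {T : Set (Site 2)}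
    (hT : {v : Site 2 | ‖triEmbed v‖ ≤ R + 1} ⊆ T) (h : ω ∩ T = ω' ∩ T) :
    lswCompact R ω = lswCompact R ω' :=
  NonemptyCompacts.ext (by simp only [coe_lswCompact, lswSet, lswSites_congr hT h])

/-- **`Q_δ` is a random compact set**: `lswCompact R` is measurable for the product σ-algebra on
configurations and the Borel σ-algebra of the Hausdorff metric (every preimage is a cylinder
event over the box of size `⌈2(R+1)⌉`). [folklore] -/
theorem measurable_lswCompact (R : ℝ) : Measurable (lswCompact R) := by
  intro t _
  have hT : {v : Site 2 | ‖triEmbed v‖ ≤ R + 1} ⊆ (↑(box 2 ⌈2 * (R + 1)⌉₊) : Set (Site 2)) :=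
    subset_box_of_norm_le fun _ hv => hv
  refine DeterminedBy.measurableSet_of_finset (F := box 2 ⌈2 * (R + 1)⌉₊) ?_
  rw [determinedBy_iff]
  intro ω ω' h
  simp only [Set.mem_preimage]
  rw [lswCompact_congr hT h]

/-- The norm of a rescaled lattice point. [folklore] -/
theorem norm_triMeshPoint_inv {R : ℝ} (hR : 0 < R) (x : Site 2) :
    ‖triMeshPoint R⁻¹ x‖ = ‖triEmbed x‖ / R := by
  simp [triMeshPoint, abs_of_pos hR, div_eq_inv_mul]

/-- **LSW's annulus crossing is a cylinder event of `Q_δ`**: for `0 < r ≤ 1` and `R > 0`,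
`C(rR, R) = {Q_{1/R} ∈ meetsBall r}`, i.e. an open path from `‖x‖ < rR` to `‖y‖ > R` exists iff
`dist(0, Q_{1/R}) < r`. [cite: LawlerSchrammWernerEJP2002, §3 (p. 8)] -/
theorem mem_triOpenCrossing_iff_lswCompact {r R : ℝ} (hr : r ≤ 1) (hR : 0 < R)
    {ω : SiteConfig (Site 2)} :
    ω ∈ triOpenCrossing (r * R) R ↔ lswCompact R ω ∈ meetsBall r := by
  rw [mem_triOpenCrossing_iff, mem_meetsBall_iff, coe_lswCompact]
  constructor
  · rintro ⟨x, y, hx, hy, hp⟩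
    have hxR : ‖triEmbed x‖ < R := lt_of_lt_of_le hx (mul_le_of_le_one_left hR.le hr)
    have hmem : triMeshPoint R⁻¹ x ∈ lswSet R ω := Or.inr ⟨x, ⟨hxR, y, hy, hp⟩, rfl⟩
    calc infDist (0 : ℂ) (lswSet R ω) ≤ dist (0 : ℂ) (triMeshPoint R⁻¹ x) :=
          infDist_le_dist_of_mem hmem
      _ = ‖triEmbed x‖ / R := by rw [dist_comm, dist_zero_right, norm_triMeshPoint_inv hR]
      _ < r := by rwa [div_lt_iff₀ hR]
  · intro h
    obtain ⟨p, hp, hdist⟩ := (infDist_lt_iff ⟨1, one_mem_lswSet R ω⟩).1 h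
    rw [dist_comm, dist_zero_right] at hdist
    rcases hp with hp | ⟨x, ⟨_, y, hy, hpath⟩, rfl⟩
    · exfalso
      have : ‖p‖ = 1 := by simpa using hp
      linarith
    · refine ⟨x, y, ?_, hy, hpath⟩
      rwa [norm_triMeshPoint_inv hR, div_lt_iff₀ hR] at hdist

/-! ### The laws of `Q_δ` -/

/-- `P_{1/2}` on `𝕋` as a bundled probability measure. [folklore] -/
def triSiteLawHalf : ProbabilityMeasure (SiteConfig (Site 2)) :=
  ⟨triSitePercolation half, inferInstance⟩

/-- The underlying measure of `triSiteLawHalf`. [folklore] -/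
@[simp] theorem coe_triSiteLawHalf :
    (triSiteLawHalf : Measure (SiteConfig (Site 2))) = triSitePercolation half :=
  rfl

/-- **The law of `Q_δ`**, `δ = 1/R`: a Borel probability measure on the Hausdorff space
`NonemptyCompacts ℂ` (LSW 2002, §2, p. 3: "The law of `Q_δ(θ)` can be thought of as a probability
measure on the Hausdorff space of compact subsets of `Ū`").
[cite: LawlerSchrammWernerEJP2002, §2 (p. 3)] -/
def lswLaw (R : ℝ) : ProbabilityMeasure (NonemptyCompacts ℂ) :=
  triSiteLawHalf.map (measurable_lswCompact R).aemeasurable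

/-- The law of `Q_δ` evaluated on a Borel set. [folklore] -/
theorem lswLaw_apply (R : ℝ) {A : Set (NonemptyCompacts ℂ)} (hA : MeasurableSet A) :
    (lswLaw R : Measure (NonemptyCompacts ℂ)) A = triSitePercolation half (lswCompact R ⁻¹' A) := by
  rw [lswLaw, ProbabilityMeasure.map_apply' _ _ hA, coe_triSiteLawHalf]

/-- `P_{1/2}[C(rR, R)] = P[Q_{1/R} ∈ meetsBall r]` for `0 < r ≤ 1`, `R > 0`.
[cite: LawlerSchrammWernerEJP2002, §3 (p. 8)] -/
theorem real_triOpenCrossing_eq {r R : ℝ} (hr : r ≤ 1) (hR : 0 < R) :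
    (triSitePercolation half).real (triOpenCrossing (r * R) R) =
      ((lswLaw R : Measure (NonemptyCompacts ℂ)) (meetsBall r)).toReal := by
  rw [lswLaw_apply R (isOpen_meetsBall r).measurableSet, measureReal_def]
  congr 2
  ext ω
  exact mem_triOpenCrossing_iff_lswCompact hr hR

/-! ### The printed continuum input, LSW Theorem 1.2, as a named fact

LSW (§2, p. 3) first assert the existence of the scaling limit: "Let `Q(θ)` denote a random subset
of `Ū` whose law is the weak limit as `δ ↓ 0` of the law of `Q_δ(θ)`. (The law of `Q_δ(θ)` can be
thought of as a probability measure on the Hausdorff space of compact subsets of `Ū`.) By [22, 23],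
the limit exists" ([22] = Smirnov, C. R. Acad. Sci. Paris 333 (2001); [23] = Smirnov, in
preparation — the 2009 long version arXiv:0909.4499, §3, Thms. 2–4, treats laws of interface
curves; the loop-ensemble scaling limit with proofs is Camia–Newman, Comm. Math. Phys. 268 (2006),
Thm. 1). In this library that existence statement is NOT a named fact: where a theorem uses it, it
is the explicit hypothesis `∃ ν : ProbabilityMeasure (NonemptyCompacts ℂ), Tendsto lswLaw atTop (𝓝 ν)`
(see the module docstring: the one-arm cone only needs subsequential weak limits, which exist by
compactness, `exists_tendsto_lswLaw_subseq`). Theorem 1.2 is recorded for every weak limit `ν`. -/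

/-- **Lawler–Schramm–Werner 2002, Theorem 1.2** (p. 2, verbatim): "Let `Q` denote the union of the
clusters meeting the unit circle `∂𝕌` in the scaling limit of critical site percolation on the
triangular lattice. There is a constant `c > 0` such that for all `r ∈ (0, 1/2)`,
`c⁻¹ r^{5/48} ≤ P[dist(Q, 0) < r] ≤ c r^{5/48}`." Recorded for every weak limit `ν` of the laws
`lswLaw R` of `Q_{1/R}` (the limit is unique, the space of probability measures being Hausdorff),
with `{dist(Q, 0) < r} = meetsBall r`. The printed proof is the radial `SLE₆` computation of §2
(Thm. 2.1, Lemma 2.2, Lemma 2.3, (2.17), Appendix A); not in Mathlib.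
[cite: LawlerSchrammWernerEJP2002, Thm. 1.2 (p. 2)] -/
def LawlerSchrammWerner2002_scalingLimitExponent : Prop :=
  ∀ ν : ProbabilityMeasure (NonemptyCompacts ℂ), Tendsto lswLaw atTop (𝓝 ν) →
    ∃ c : ℝ, 0 < c ∧ ∀ r : ℝ, 0 < r → r < 1 / 2 →
      c⁻¹ * r ^ (5 / 48 : ℝ) ≤ (ν : Measure (NonemptyCompacts ℂ)).real (meetsBall r) ∧
        (ν : Measure (NonemptyCompacts ℂ)).real (meetsBall r) ≤ c * r ^ (5 / 48 : ℝ)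

/-! ### "By Theorem 1.2, `log u(r) / log r → 5/48`" -/

/-- Two-sided power bounds near `0⁺` determine the logarithmic exponent: if
`L r^a ≤ u(r) ≤ U r^a` for `0 < r < δ` with `L, U > 0`, then `log u(r) / log r → a` as `r ↓ 0`
(LSW 2002, p. 9, first line). [folklore] -/
theorem tendsto_log_div_log_of_rpow_bounds {u : ℝ → ℝ} {a L U δ : ℝ} (hL : 0 < L) (hU : 0 < U)
    (hδ : 0 < δ) (h : ∀ r, 0 < r → r < δ → L * r ^ a ≤ u r ∧ u r ≤ U * r ^ a) :
    Tendsto (fun r => Real.log (u r) / Real.log r) (𝓝[>] 0) (𝓝 a) := by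
  have hinv : Tendsto (fun r => (Real.log r)⁻¹) (𝓝[>] (0 : ℝ)) (𝓝 0) :=
    Real.tendsto_log_nhdsGT_zero.inv_tendsto_atBot
  have hev : ∀ᶠ r in 𝓝[>] (0 : ℝ), 0 < r ∧ r < min δ (1 / 2) := by
    filter_upwards [Ioo_mem_nhdsGT (show (0 : ℝ) < min δ (1 / 2) from lt_min hδ (by norm_num))]
      with r hr using ⟨hr.1, hr.2⟩
  set M : ℝ := max |Real.log L| |Real.log U| with hM
  have key : ∀ r, 0 < r → r < min δ (1 / 2) →
      Real.log (u r) / Real.log r = a + (Real.log (u r) - a * Real.log r) * (Real.log r)⁻¹ ∧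
      |Real.log (u r) - a * Real.log r| ≤ M := by
    intro r hr0 hr1
    have hrδ : r < δ := lt_of_lt_of_le hr1 (min_le_left _ _)
    have hr1' : r < 1 := by linarith [min_le_right δ (1 / 2 : ℝ)]
    have hlogr : Real.log r < 0 := Real.log_neg hr0 hr1'
    obtain ⟨h1, h2⟩ := h r hr0 hrδ
    have hra : 0 < r ^ a := Real.rpow_pos_of_pos hr0 a
    have hu0 : 0 < u r := lt_of_lt_of_le (by positivity) h1
    refine ⟨?_, ?_⟩
    · have hne : Real.log r ≠ 0 := hlogr.ne
      field_simp
      ring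
    · have e1 : Real.log (L * r ^ a) = Real.log L + a * Real.log r := by
        rw [Real.log_mul hL.ne' hra.ne', Real.log_rpow hr0]
      have e2 : Real.log (U * r ^ a) = Real.log U + a * Real.log r := by
        rw [Real.log_mul hU.ne' hra.ne', Real.log_rpow hr0]
      have i1 : Real.log L + a * Real.log r ≤ Real.log (u r) :=
        e1 ▸ Real.log_le_log (by positivity) h1
      have i2 : Real.log (u r) ≤ Real.log U + a * Real.log r := e2 ▸ Real.log_le_log hu0 h2
      rw [abs_le]
      constructor
      · calc -M ≤ -|Real.log L| := neg_le_neg (le_max_left _ _)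
          _ ≤ Real.log L := neg_abs_le _
          _ ≤ _ := by linarith
      · calc Real.log (u r) - a * Real.log r ≤ Real.log U := by linarith
          _ ≤ |Real.log U| := le_abs_self _
          _ ≤ M := le_max_right _ _
  have hg : Tendsto (fun r => (Real.log (u r) - a * Real.log r) * (Real.log r)⁻¹)
      (𝓝[>] 0) (𝓝 0) := by
    have hMlim : Tendsto (fun r => M * ‖(Real.log r)⁻¹‖) (𝓝[>] (0 : ℝ)) (𝓝 0) := by
      simpa using hinv.norm.const_mul M
    refine squeeze_zero_norm' ?_ hMlim
    filter_upwards [hev] with r hr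
    calc ‖(Real.log (u r) - a * Real.log r) * (Real.log r)⁻¹‖
        = |Real.log (u r) - a * Real.log r| * ‖(Real.log r)⁻¹‖ := by
          rw [norm_mul, Real.norm_eq_abs]
      _ ≤ M * ‖(Real.log r)⁻¹‖ :=
          mul_le_mul_of_nonneg_right (key r hr.1 hr.2).2 (norm_nonneg _)
  have hlim : Tendsto (fun r => a + (Real.log (u r) - a * Real.log r) * (Real.log r)⁻¹)
      (𝓝[>] 0) (𝓝 a) := by
    simpa using tendsto_const_nhds.add hg
  refine hlim.congr' ?_
  filter_upwards [hev] with r hr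
  exact ((key r hr.1 hr.2).1).symm

/-! ### LSW (3.1) "by the definition of the scaling limit", and the assembly -/

/-- **LSW's continuum input from its two printed parts.** The existence of the scaling limit `Q`
of the clusters meeting `∂𝕌` (hypothesis `h₁`: the laws `lswLaw R` of `Q_{1/R}` converge weakly as
`R → ∞`; LSW §2, p. 3, "By [22, 23], the limit exists") and Thm. 1.2 for `Q`
(`LawlerSchrammWerner2002_scalingLimitExponent`) imply `LawlerSchrammWerner2002_annulusCrossing`,
with `u(r) = P[Q ∈ meetsClosedBall r]`: the bounds (3.1), "`∀ R ≥ s₀, u(r/2)/2 ≤ P[C(rR, R)] ≤ 2u(2r)`"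
("By the definition of the scaling limit", LSW p. 8) follow from the portmanteau theorem for the
closed event `meetsClosedBall r` and the open event `meetsBall r ⊇ meetsClosedBall (r/2)` of the
Hausdorff space together with `C(rR, R) = {Q_{1/R} ∈ meetsBall r}` and the positivity of `u` given
by Thm. 1.2; and "By Theorem 1.2, `log u(r) / log r → 5/48`" (p. 9) since
`c⁻¹ r^{5/48} ≤ P[Q ∈ meetsBall r] ≤ u(r) ≤ P[Q ∈ meetsBall 2r] ≤ c (2r)^{5/48}` for `r < 1/4`.
[cite: LawlerSchrammWernerEJP2002, §3 (3.1) (p. 8) and p. 9] -/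
theorem LawlerSchrammWerner2002_annulusCrossing_of_scalingLimit
    (h₁ : ∃ ν : ProbabilityMeasure (NonemptyCompacts ℂ), Tendsto lswLaw atTop (𝓝 ν))
    (h₂ : LawlerSchrammWerner2002_scalingLimitExponent) :
    LawlerSchrammWerner2002_annulusCrossing := by
  obtain ⟨ν, hν⟩ := h₁
  obtain ⟨c, hc, hb⟩ := h₂ ν hν
  set μ : Measure (NonemptyCompacts ℂ) := (ν : Measure (NonemptyCompacts ℂ)) with hμ
  -- `u(r) = P[Q meets the closed disc of radius r]`
  refine ⟨fun r => (μ (meetsClosedBall r)).toReal, ?_, ?_⟩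
  · -- "By Theorem 1.2, log u(r) / log r → 5/48"
    have h2pow : (0 : ℝ) < (2 : ℝ) ^ (5 / 48 : ℝ) := Real.rpow_pos_of_pos (by norm_num) _
    refine tendsto_log_div_log_of_rpow_bounds (L := c⁻¹) (U := c * (2 : ℝ) ^ (5 / 48 : ℝ))
      (δ := 1 / 4) (inv_pos.2 hc) (mul_pos hc h2pow) (by norm_num) fun r hr0 hr4 => ?_
    obtain ⟨hl, -⟩ := hb r hr0 (by linarith)
    obtain ⟨-, hu⟩ := hb (2 * r) (by linarith) (by linarith)
    constructor
    · calc c⁻¹ * r ^ (5 / 48 : ℝ) ≤ μ.real (meetsBall r) := hl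
        _ = (μ (meetsBall r)).toReal := measureReal_def _ _
        _ ≤ (μ (meetsClosedBall r)).toReal :=
          ENNReal.toReal_mono (measure_ne_top _ _) (measure_mono (meetsBall_subset_meetsClosedBall r))
    · calc (μ (meetsClosedBall r)).toReal ≤ (μ (meetsBall (2 * r))).toReal :=
            ENNReal.toReal_mono (measure_ne_top _ _)
              (measure_mono (meetsClosedBall_subset_meetsBall (by linarith)))
        _ = μ.real (meetsBall (2 * r)) := (measureReal_def _ _).symm
        _ ≤ c * (2 * r) ^ (5 / 48 : ℝ) := hu
        _ = c * (2 : ℝ) ^ (5 / 48 : ℝ) * r ^ (5 / 48 : ℝ) := by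
          rw [Real.mul_rpow (by norm_num) hr0.le, mul_assoc]
  · -- (3.1) by the portmanteau theorem
    intro r hr0 hr2
    -- positivity of the limit probabilities, from Thm. 1.2
    have hpos : ∀ s, 0 < s → s < 1 / 2 → μ (meetsBall s) ≠ 0 := by
      intro s hs0 hs2 h0
      obtain ⟨hl, -⟩ := hb s hs0 hs2
      have : μ.real (meetsBall s) = 0 := by rw [measureReal_def, h0, ENNReal.toReal_zero]
      have : (0 : ℝ) < c⁻¹ * s ^ (5 / 48 : ℝ) :=
        mul_pos (inv_pos.2 hc) (Real.rpow_pos_of_pos hs0 _)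
      linarith
    -- upper bound: limsup P[Q_δ ∈ F_r] ≤ ν(F_r) < 2 ν(F_r)
    have hF0 : μ (meetsClosedBall r) ≠ 0 := fun h0 =>
      hpos r hr0 hr2 (measure_mono_null (meetsBall_subset_meetsClosedBall r) h0)
    have hlimsup : limsup (fun R => (lswLaw R : Measure (NonemptyCompacts ℂ)) (meetsClosedBall r))
        atTop ≤ μ (meetsClosedBall r) :=
      ProbabilityMeasure.limsup_measure_closed_le_of_tendsto hν (isClosed_meetsClosedBall r)
    have hup : ∀ᶠ R : ℝ in atTop, (lswLaw R : Measure (NonemptyCompacts ℂ)) (meetsClosedBall r) <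
        μ (meetsClosedBall r) + μ (meetsClosedBall r) :=
      eventually_lt_of_limsup_lt
        (hlimsup.trans_lt (ENNReal.lt_add_right (measure_ne_top _ _) hF0))
    -- lower bound: liminf P[Q_δ ∈ O_r] ≥ ν(O_r) ≥ ν(F_{r/2}) > ν(F_{r/2}) / 2
    have hF0' : μ (meetsClosedBall (r / 2)) ≠ 0 := fun h0 =>
      hpos (r / 2) (by linarith) (by linarith)
        (measure_mono_null (meetsBall_subset_meetsClosedBall (r / 2)) h0)
    have hliminf : μ (meetsBall r) ≤
        liminf (fun R => (lswLaw R : Measure (NonemptyCompacts ℂ)) (meetsBall r)) atTop :=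
      ProbabilityMeasure.le_liminf_measure_open_of_tendsto hν (isOpen_meetsBall r)
    have hlow : ∀ᶠ R : ℝ in atTop, μ (meetsClosedBall (r / 2)) / 2 <
        (lswLaw R : Measure (NonemptyCompacts ℂ)) (meetsBall r) := by
      refine eventually_lt_of_lt_liminf (lt_of_lt_of_le ?_ hliminf)
      calc μ (meetsClosedBall (r / 2)) / 2 < μ (meetsClosedBall (r / 2)) :=
            ENNReal.half_lt_self hF0' (measure_ne_top _ _)
        _ ≤ μ (meetsBall r) := measure_mono (meetsClosedBall_subset_meetsBall (by linarith))
    obtain ⟨s₀, hs₀⟩ := eventually_atTop.1 (hup.and (hlow.and (eventually_gt_atTop (0 : ℝ))))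
    refine ⟨s₀, fun R hR => ?_⟩
    obtain ⟨hupR, hlowR, hR0⟩ := hs₀ R hR
    rw [real_triOpenCrossing_eq (by linarith) hR0]
    constructor
    · -- u(r/2)/2 ≤ P[C(rR, R)]
      calc (μ (meetsClosedBall (r / 2))).toReal / 2 = (μ (meetsClosedBall (r / 2)) / 2).toReal := by
            rw [ENNReal.toReal_div, ENNReal.toReal_ofNat]
        _ ≤ ((lswLaw R : Measure (NonemptyCompacts ℂ)) (meetsBall r)).toReal :=
          ENNReal.toReal_mono (measure_ne_top _ _) hlowR.le
    · -- P[C(rR, R)] ≤ 2 u(2r)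
      calc ((lswLaw R : Measure (NonemptyCompacts ℂ)) (meetsBall r)).toReal
          ≤ ((lswLaw R : Measure (NonemptyCompacts ℂ)) (meetsClosedBall r)).toReal :=
            ENNReal.toReal_mono (measure_ne_top _ _)
              (measure_mono (meetsBall_subset_meetsClosedBall r))
        _ ≤ (μ (meetsClosedBall r) + μ (meetsClosedBall r)).toReal :=
            ENNReal.toReal_mono (ENNReal.add_ne_top.2 ⟨measure_ne_top _ _, measure_ne_top _ _⟩)
              hupR.le
        _ = 2 * (μ (meetsClosedBall r)).toReal := by
            rw [ENNReal.toReal_add (measure_ne_top _ _) (measure_ne_top _ _), two_mul]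
        _ ≤ 2 * (μ (meetsClosedBall (2 * r))).toReal := by
            gcongr
            · exact measure_ne_top _ _
            · exact meetsClosedBall_mono (by linarith)

/-- **The one-arm exponent from the scaling limit, Thm. 1.2 and RSW circuits** (LSW 2002,
Thm. 1.1, proof of §3): `oneArm_exponent` from the existence of the weak limit of `lswLaw`
(LSW §2, p. 3), `LawlerSchrammWerner2002_scalingLimitExponent` and `BollobasRiordan2006_openCircuit`.
[cite: LawlerSchrammWernerEJP2002, Thm. 1.1 and §3 (pp. 8–9)] -/
theorem oneArm_exponent_of_scalingLimit
    (h₁ : ∃ ν : ProbabilityMeasure (NonemptyCompacts ℂ), Tendsto lswLaw atTop (𝓝 ν))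
    (h₂ : LawlerSchrammWerner2002_scalingLimitExponent) (h₃ : BollobasRiordan2006_openCircuit) :
    oneArm_exponent :=
  oneArm_exponent_of_LSW (LawlerSchrammWerner2002_annulusCrossing_of_scalingLimit h₁ h₂) h₃

/-- **The one-arm exponent from the scaling limit, Thm. 1.2 and the RSW box-crossing property**
(LSW 2002, Thm. 1.1): `oneArm_exponent` from the existence of the weak limit of `lswLaw` (LSW §2,
p. 3), `LawlerSchrammWerner2002_scalingLimitExponent` and `tri_rsw_half` (via
`oneArm_exponent_of_LSW_of_rsw`, `TriAnnulusCircuit.lean`). For the unconditional route see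
`oneArm_exponent_of_subseqTrace` (`OneArmFromTrace.lean`), which needs no scaling limit.
[cite: LawlerSchrammWernerEJP2002, Thm. 1.1 and §3 (pp. 8–9)] -/
theorem oneArm_exponent_of_scalingLimit_of_rsw
    (h₁ : ∃ ν : ProbabilityMeasure (NonemptyCompacts ℂ), Tendsto lswLaw atTop (𝓝 ν))
    (h₂ : LawlerSchrammWerner2002_scalingLimitExponent) (h₃ : tri_rsw_half) : oneArm_exponent :=
  oneArm_exponent_of_LSW_of_rsw (LawlerSchrammWerner2002_annulusCrossing_of_scalingLimit h₁ h₂) h₃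

end Literature.Probability.Percolation
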